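import Mathlib.Algebra.CharP.Lemmas
import Mathlib.Algebra.Module.ZMod
import Mathlib.FieldTheory.Finite.GaloisField
import Mathlib.LinearAlgebra.FiniteDimensional.Lemmas
import Mathlib.LinearAlgebra.Isomorphisms
import Mathlib.LinearAlgebra.Quotient.Card
import Mathlib.Algebra.Polynomial.AlgebraMap
import HarnessLib

/-!
# The rank-jump lemma: `[M : ν_k Y + pM] < p^{p^k - p^j} · [M : ν_j Y + pM]` forces `ν_{k'} Y ⊆ pM` for every `k' ≥ k`
# (the module algebra of a TWO-LAYER «small rank jump» criterion for rank stabilisation and `μ = 0`; proved)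

`Proofs`-style file (theorems only: no definition, no named fact, no `sorry`) in topic `NumberTheory/IwasawaTheory`
(namespace `Literature.NumberTheory.IwasawaTheory.FukudaRankJump`), written by the prover seat `bsd-line-att-p3` g40
(cell `bsd-f1-sign2`, route `AlignedTransportAtTwo`; `--supports` stmt-BirchSwinnertonDyer-22298, closes nothing).
Sibling `ClassGroupPRankStableOfRankJumpLt` turns it, through the tree's finite-level package of Fukuda's theorem
(`Fukuda1994Thm1RankPackage.exists_layer_package`, `FukudaGroupLayers`), into: **if a `ℤ_p`-extension is totally ramified above
`p` from layer `n`, and `rank_p Cl(K_{n+k}) - rank_p Cl(K_{n+j}) < p^k - p^j` for ONE pair `j ≤ k`, then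
`rank_p Cl(K_m) = rank_p Cl(K_{n+k})` for EVERY `m ≥ n + k`** (hence `μ = 0` and `λ ≤ rank_p Cl(K_{n+k})`).  Companion of
`FukudaSmallRankAlgebra` (cell `bsd-potss`), whose ONE-layer lemma is the case `j = 0` with the rank of layer `n` forgotten.

THE LEMMA (`map_geom_sum_le_of_card_quotient_mul_lt`).  `M` a finite abelian group, `φ ∈ End_ℤ(M)` with `φ^{p^t} = 1`, `Y ≤ M` a
`φ`-STABLE subgroup, `ν_i = ∑_{l<p^i} φ^l`, `pM` the multiples of `p`, `S_i = ν_i Y + pM`.  If `j ≤ k` and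
`#(M/S_k) · p^{p^j} < #(M/S_j) · p^{p^k}` (i.e. `log_p #(M/S_k) - log_p #(M/S_j) < p^k - p^j`) then `ν_{k'} Y ⊆ pM` for every
`k' ≥ k` — so all the `S_{k'}`, `k' ≥ k`, equal `pM` and have the same index (`card_quotient_eq_of_card_quotient_mul_lt`).
Proof.  On `M̄ = M/pM` (an `𝔽_p`-vector space) `T = φ̄ - 1` is nilpotent (`T^{p^t} = φ̄^{p^t} - 1 = 0`, Frobenius) and
`ν̄_i = ∑_{l<p^i} (1+T)^l = T^{p^i-1}` (the identity `X · ∑_{l<p^i}(1+X)^l = (1+X)^{p^i} - 1 = X^{p^i}` in `𝔽_p[X]`), so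
`#(M/S_i) = #(M̄ / T^{p^i - 1}W̄)` with `W̄` the image of `Y`, a `T`-stable subspace.  For a `T`-stable `W̄` the chain
`W̄ ⊇ TW̄ ⊇ T²W̄ ⊇ ⋯` is STRICT as long as it is non-zero (an equality `T^{i+1}W̄ = T^iW̄` propagates to `T^iW̄ = T^{i+m}W̄ = 0`,
`T` nilpotent), so `dim T^aW̄ - dim T^bW̄ ≥ b - a` unless `T^bW̄ = 0` (§1, `finrank_map_pow_add_le`); with `a = p^j - 1`,
`b = p^k - 1` the hypothesis says the contrary, hence `T^{p^k-1}W̄ = 0`, hence `T^{p^{k'}-1}W̄ = 0` and `ν̄_{k'}W̄ = 0` for all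
`k' ≥ k`.  This is the module-theoretic shadow of «`μ(X) > 0 ⟹ X/pX` has a free `𝔽_p⟦T⟧`-summand ⟹
`rank_p A_{n+k} - rank_p A_{n+j} ≥ p^k - p^j`» (Washington §13.3, structure of `X/(ν_{n,m}Y_n + pX) ≅ A_m/pA_m`), at finite
level and without the structure theory.  `T`-stability of `W̄` is NECESSARY (`V = 𝔽_p²`, `T e₂ = e₁`, `T e₁ = 0`, `W̄ = ⟨e₂⟩`:
`dim W̄ = dim TW̄ = 1` but `TW̄ ≠ 0`); in the application `Y = Y₀ = N₀ ∩ A` IS `φ`-stable (`FukudaGroup.conjEnd_mem_subOf_commutator_sup`).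

References: [Washington1997] L. Washington, *Introduction to Cyclotomic Fields*, 2nd ed., GTM 83, §13.3 Lemmas 13.15, 13.18,
Prop. 13.22–13.23; [Fukuda1994] T. Fukuda, *Remarks on ℤ_p-extensions of number fields*, Proc. Japan Acad. 70 A (1994), Thm. 1
(the finite-level method).
-/

set_option autoImplicit false

noncomputable section

open Finset Polynomial Module

namespace Literature.NumberTheory.IwasawaTheory.FukudaRankJump

/-! ## §1 A nilpotent operator and a stable subspace `W`: the chain `W ⊇ TW ⊇ T²W ⊇ ⋯` is strict while non-zero -/

section Nilpotent

variable {F : Type*} [Field F] {V : Type*} [AddCommGroup V] [Module F V] [FiniteDimensional F V]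

omit [FiniteDimensional F V] in
/-- For a `T`-stable subspace `W`, `T^{i+1}W ⊆ T^iW`. [folklore] -/
private theorem map_pow_succ_le (T : V →ₗ[F] V) {W : Submodule F V} (hW : W.map T ≤ W) (i : ℕ) :
    W.map (T ^ (i + 1)) ≤ W.map (T ^ i) := by
  rw [pow_succ, Module.End.mul_eq_comp, Submodule.map_comp]
  exact Submodule.map_mono hW

omit [FiniteDimensional F V] in
/-- If `T^{i+1}W = T^iW` then `T^{i+m}W = T^iW` for every `m` (no stability needed). [folklore] -/
private theorem map_pow_add_eq_of_map_pow_succ_eq (T : V →ₗ[F] V) {W : Submodule F V} {i : ℕ}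
    (h : W.map (T ^ (i + 1)) = W.map (T ^ i)) (m : ℕ) : W.map (T ^ (i + m)) = W.map (T ^ i) := by
  induction m with
  | zero => rw [add_zero]
  | succ m ih =>
    have h1 : T ^ (i + (m + 1)) = T * T ^ (i + m) := by rw [← add_assoc, pow_succ']
    have h2 : T ^ (i + 1) = T * T ^ i := pow_succ' T i
    rw [h1, Module.End.mul_eq_comp, Submodule.map_comp, ih, ← Submodule.map_comp, ← Module.End.mul_eq_comp, ← h2, h]

omit [FiniteDimensional F V] in
/-- For a nilpotent `T` (`T^N = 0`): an equality `T^{i+1}W = T^iW` forces `T^iW = 0`. [folklore] -/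
private theorem map_pow_eq_bot_of_map_pow_succ_eq (T : V →ₗ[F] V) {N : ℕ} (hN : T ^ N = 0) {W : Submodule F V} {i : ℕ}
    (h : W.map (T ^ (i + 1)) = W.map (T ^ i)) : W.map (T ^ i) = ⊥ := by
  rw [← map_pow_add_eq_of_map_pow_succ_eq T h N, pow_add, hN, mul_zero, Submodule.map_zero]

omit [FiniteDimensional F V] in
/-- `T^bW = 0 ⟹ T^cW = 0` for `c ≥ b`. [folklore] -/
private theorem map_pow_eq_bot_of_le (T : V →ₗ[F] V) {W : Submodule F V} {b c : ℕ} (hbc : b ≤ c) (hb : W.map (T ^ b) = ⊥) :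
    W.map (T ^ c) = ⊥ := by
  obtain ⟨d, rfl⟩ := Nat.exists_eq_add_of_le hbc
  rw [add_comm, pow_add, Module.End.mul_eq_comp, Submodule.map_comp, hb, Submodule.map_bot]

/-- **`dim T^bW + (b - a) ≤ dim T^aW` for a nilpotent `T`, a `T`-stable `W`, `a ≤ b` and `T^bW ≠ 0`**: the chain
`T^aW ⊋ T^{a+1}W ⊋ ⋯ ⊋ T^bW` is strict (an equality `T^{i+1}W = T^iW` would force `T^iW = T^{i+N}W = 0`).  The case `W = V`, `a = 0`
is `FukudaSmallRank.finrank_range_pow_add_le`. [cite: Washington1997, §13.3 Prop. 13.22 (proof: Nakayama-type chain argument)] -/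
theorem finrank_map_pow_add_le (T : V →ₗ[F] V) {N : ℕ} (hN : T ^ N = 0) {W : Submodule F V} (hW : W.map T ≤ W)
    {a b : ℕ} (hab : a ≤ b) (hb : W.map (T ^ b) ≠ ⊥) :
    finrank F (W.map (T ^ b)) + (b - a) ≤ finrank F (W.map (T ^ a)) := by
  induction b, hab using Nat.le_induction with
  | base => simp
  | succ b hab ih =>
    -- `T^bW ≠ 0` (it contains `T^{b+1}W ≠ 0`)
    have hle : W.map (T ^ (b + 1)) ≤ W.map (T ^ b) := map_pow_succ_le T hW b
    have hb' : W.map (T ^ b) ≠ ⊥ := by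
      intro h0
      exact hb (le_bot_iff.mp (h0 ▸ hle))
    have hne : W.map (T ^ (b + 1)) ≠ W.map (T ^ b) := fun heq =>
      hb' (map_pow_eq_bot_of_map_pow_succ_eq T hN heq)
    have hlt : W.map (T ^ (b + 1)) < W.map (T ^ b) := lt_of_le_of_ne hle hne
    have h1 := Submodule.finrank_lt_finrank_of_lt hlt
    have h2 := ih hb'
    omega

/-- **Contrapositive (the form used): a rank jump `dim T^aW - dim T^bW < b - a` forces `T^bW = 0`.**
[cite: Washington1997, §13.3 Prop. 13.22–13.23] -/
theorem map_pow_eq_bot_of_finrank_lt (T : V →ₗ[F] V) {N : ℕ} (hN : T ^ N = 0) {W : Submodule F V} (hW : W.map T ≤ W)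
    {a b : ℕ} (hab : a ≤ b) (hlt : finrank F (W.map (T ^ a)) < finrank F (W.map (T ^ b)) + (b - a)) :
    W.map (T ^ b) = ⊥ := by
  by_contra hb
  have := finrank_map_pow_add_le T hN hW hab hb
  omega

end Nilpotent

/-! ## §2 Two polynomial identities in characteristic `p` -/

section CharP

variable {p : ℕ} [Fact p.Prime]

/-- `∑_{l<p^i} (1+X)^l = X^{p^i - 1}` in `𝔽_p[X]` (`X · ∑ (1+X)^l = (1+X)^{p^i} - 1 = X^{p^i}`). [folklore] -/
private theorem geom_sum_one_add_X (i : ℕ) :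
    (∑ l ∈ range (p ^ i), ((1 : (ZMod p)[X]) + X) ^ l) = X ^ (p ^ i - 1) := by
  have hp : p.Prime := Fact.out
  have h := geom_sum_mul ((1 : (ZMod p)[X]) + X) (p ^ i)
  rw [add_sub_cancel_left, add_pow_char_pow, one_pow, add_sub_cancel_left] at h
  have hX : (X : (ZMod p)[X]) ≠ 0 := X_ne_zero
  have hpi : 1 ≤ p ^ i := Nat.one_le_pow _ _ hp.pos
  refine mul_right_cancel₀ hX ?_
  rw [h, ← pow_succ, Nat.sub_add_cancel hpi]

/-- `∑_{l<p^i} (1+T)^l = T^{p^i - 1}` for `T` in any `𝔽_p`-algebra. [folklore] -/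
private theorem geom_sum_one_add_eq_pow {A : Type*} [Ring A] [Algebra (ZMod p) A] (T : A) (i : ℕ) :
    (∑ l ∈ range (p ^ i), (1 + T) ^ l) = T ^ (p ^ i - 1) := by
  have h := congrArg (Polynomial.aeval T) (geom_sum_one_add_X (p := p) i)
  rw [map_sum, map_pow, aeval_X] at h
  simp_rw [map_pow, map_add, map_one, aeval_X] at h
  exact h

/-- `(ψ - 1)^{p^t} = ψ^{p^t} - 1` for `ψ` in any `𝔽_p`-algebra. [folklore] -/
private theorem sub_one_pow_char_pow {A : Type*} [Ring A] [Algebra (ZMod p) A] (ψ : A) (t : ℕ) :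
    (ψ - 1) ^ p ^ t = ψ ^ p ^ t - 1 := by
  have hpoly : ((X : (ZMod p)[X]) - 1) ^ p ^ t = X ^ p ^ t - 1 := by
    rw [sub_pow_char_pow, one_pow]
  have h := congrArg (Polynomial.aeval ψ) hpoly
  rw [map_pow, map_sub, map_sub, map_pow, aeval_X, map_one] at h
  exact h

end CharP

/-! ## §3 The rank-jump lemma -/

section RankJump

variable {p : ℕ} [Fact p.Prime] {M : Type*} [AddCommGroup M] [Finite M]

/-- **The rank-jump lemma.**  `M` a finite abelian group, `φ ∈ End_ℤ(M)` with `φ^{p^t} = 1`, `Y ≤ M` a `φ`-stable subgroup,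
`ν_i = ∑_{l<p^i} φ^l`, `pM` = the image of multiplication by `p`, `S_i = ν_i Y + pM`: if `j ≤ k` and `#(M/S_k) · p^{p^j} < #(M/S_j) · p^{p^k}`
then `ν_{k'} Y ⊆ pM` for every `k' ≥ k`.  (On `M̄ = M/pM`: `T = φ̄ - 1` is nilpotent, `ν̄_i = T^{p^i-1}`, `W̄ = Ȳ` is `T`-stable, and
`dim T^aW̄ - dim T^bW̄ ≥ b - a` unless `T^bW̄ = 0`.)
[cite: Washington1997, §13.3 Lemma 13.18 and Prop. 13.22–13.23] [cite: Fukuda1994, Thm. 1 (proof, p. 264)] -/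
theorem map_geom_sum_le_of_card_quotient_mul_lt (φ : Module.End ℤ M) {t : ℕ} (hφ : φ ^ p ^ t = 1) (Y : Submodule ℤ M)
    (hY : Y.map φ ≤ Y) {j k : ℕ} (hjk : j ≤ k)
    (hlt : Nat.card (M ⧸ (Y.map (∑ l ∈ range (p ^ k), φ ^ l) ⊔ (⊤ : Submodule ℤ M).map ((p : ℤ) • (1 : Module.End ℤ M)))) *
        p ^ (p ^ j) <
      Nat.card (M ⧸ (Y.map (∑ l ∈ range (p ^ j), φ ^ l) ⊔ (⊤ : Submodule ℤ M).map ((p : ℤ) • (1 : Module.End ℤ M)))) *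
        p ^ (p ^ k))
    {k' : ℕ} (hk' : k ≤ k') :
    Y.map (∑ l ∈ range (p ^ k'), φ ^ l) ≤ (⊤ : Submodule ℤ M).map ((p : ℤ) • (1 : Module.End ℤ M)) := by
  have hp : p.Prime := Fact.out
  set P : Submodule ℤ M := (⊤ : Submodule ℤ M).map ((p : ℤ) • (1 : Module.End ℤ M)) with hPdef
  -- `ν_i` and `c_i = p^i - 1`
  have hmemP : ∀ m : M, (p : ℤ) • m ∈ P := fun m =>
    Submodule.mem_map.mpr ⟨m, Submodule.mem_top, by rw [LinearMap.smul_apply, Module.End.one_apply]⟩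
  have hPφ : P ≤ P.comap φ := by
    intro x hx
    obtain ⟨m, -, rfl⟩ := Submodule.mem_map.mp hx
    rw [Submodule.mem_comap, LinearMap.smul_apply, Module.End.one_apply, map_zsmul]
    exact hmemP _
  -- the `𝔽_p`-vector space `M̄ = M/pM`
  have hpQ : ∀ x : M ⧸ P, p • x = 0 := by
    intro x
    induction x using Submodule.Quotient.induction_on with
    | H m =>
      have hm : (p • m : M) ∈ P := by rw [← natCast_zsmul]; exact hmemP m
      have h := map_nsmul P.mkQ p m
      rw [Submodule.mkQ_apply, Submodule.mkQ_apply] at h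
      rw [← h]
      exact (Submodule.Quotient.mk_eq_zero P).mpr hm
  haveI : Module (ZMod p) (M ⧸ P) := AddCommGroup.zmodModule hpQ
  haveI : Finite (M ⧸ P) := Finite.of_surjective _ (Submodule.Quotient.mk_surjective P)
  -- `φ̄` on `M̄` (`ℤ`-linear), and `ψ` = the same map `𝔽_p`-linearly; `T = ψ - 1`, `T^{p^t} = 0`
  set φbar : (M ⧸ P) →ₗ[ℤ] (M ⧸ P) := P.mapQ P φ hPφ with hφbar
  have hφbar_mk : ∀ m : M, φbar (Submodule.Quotient.mk m) = Submodule.Quotient.mk (φ m) := fun m =>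
    Submodule.mapQ_apply P P φ m
  set ψ : (M ⧸ P) →ₗ[ZMod p] (M ⧸ P) := φbar.toAddMonoidHom.toZModLinearMap p with hψdef
  have hψ_mk : ∀ m : M, ψ (Submodule.Quotient.mk m) = Submodule.Quotient.mk (φ m) := fun m => hφbar_mk m
  have hψ_pow_mk : ∀ (l : ℕ) (m : M), (ψ ^ l) (Submodule.Quotient.mk m) = Submodule.Quotient.mk ((φ ^ l) m) := by
    intro l
    induction l with
    | zero => intro m; rw [pow_zero, pow_zero, Module.End.one_apply, Module.End.one_apply]
    | succ l ih => intro m; rw [pow_succ, pow_succ, Module.End.mul_apply, Module.End.mul_apply, hψ_mk, ih]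
  have hψt : ψ ^ p ^ t = 1 := by
    refine LinearMap.ext fun x => ?_
    induction x using Submodule.Quotient.induction_on with
    | H m => rw [hψ_pow_mk, hφ, Module.End.one_apply, Module.End.one_apply]
  set T : Module.End (ZMod p) (M ⧸ P) := ψ - 1 with hTdef
  have hTnil : T ^ p ^ t = 0 := by
    rw [hTdef, sub_one_pow_char_pow (p := p) ψ t, hψt, sub_self]
  -- `ν̄_i = T^{c_i}` pointwise: `mk (ν_i m) = T^{p^i - 1} (mk m)`
  have hν_mk : ∀ (i : ℕ) (m : M),
      Submodule.Quotient.mk (p := P) ((∑ l ∈ range (p ^ i), φ ^ l) m) = (T ^ (p ^ i - 1)) (Submodule.Quotient.mk m) := by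
    intro i m
    have h2 : (∑ l ∈ range (p ^ i), ψ ^ l) = T ^ (p ^ i - 1) := by
      rw [← geom_sum_one_add_eq_pow (p := p) T i, hTdef]
      simp_rw [add_sub_cancel]
    rw [← h2, LinearMap.sum_apply, LinearMap.sum_apply,
      show (Submodule.Quotient.mk (p := P) (∑ l ∈ range (p ^ i), (φ ^ l) m)) =
        ∑ l ∈ range (p ^ i), Submodule.Quotient.mk (p := P) ((φ ^ l) m) from map_sum (P.mkQ) _ _]
    exact Finset.sum_congr rfl fun l _ => (hψ_pow_mk l m).symm
  -- `W̄` = the image of `Y` in `M̄`, an `𝔽_p`-subspace, `T`-stable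
  set W : Submodule (ZMod p) (M ⧸ P) :=
    { carrier := {x | ∃ y ∈ Y, Submodule.Quotient.mk y = x}
      add_mem' := by
        rintro _ _ ⟨y, hy, rfl⟩ ⟨y', hy', rfl⟩
        exact ⟨y + y', Y.add_mem hy hy', map_add P.mkQ y y'⟩
      zero_mem' := ⟨0, Y.zero_mem, map_zero P.mkQ⟩
      smul_mem' := by
        rintro c _ ⟨y, hy, rfl⟩
        refine ⟨c.val • y, nsmul_mem hy _, ?_⟩
        have h1 : Submodule.Quotient.mk (p := P) (c.val • y) = c.val • Submodule.Quotient.mk (p := P) y :=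
          map_nsmul P.mkQ c.val y
        rw [h1, ← Nat.cast_smul_eq_nsmul (ZMod p), ZMod.natCast_zmod_val] }
    with hWdef
  have hmemW : ∀ x : M ⧸ P, x ∈ W ↔ ∃ y ∈ Y, Submodule.Quotient.mk y = x := fun x => Iff.rfl
  have hWT : W.map T ≤ W := by
    rintro _ ⟨x, hx, rfl⟩
    obtain ⟨y, hy, rfl⟩ := (hmemW x).mp hx
    refine (hmemW _).mpr ⟨φ y - y, Y.sub_mem (hY ⟨y, hy, rfl⟩) hy, ?_⟩
    rw [hTdef, LinearMap.sub_apply, Module.End.one_apply, hψ_mk, Submodule.Quotient.mk_sub]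
  -- `T^cW̄` has the same elements as the image of `S_i` in `M̄` when `c = p^i - 1`
  have hmem_mapT : ∀ (i : ℕ) (x : M ⧸ P),
      x ∈ W.map (T ^ (p ^ i - 1)) ↔ ∃ y ∈ Y, Submodule.Quotient.mk ((∑ l ∈ range (p ^ i), φ ^ l) y) = x := by
    intro i x
    constructor
    · rintro ⟨w, hw, rfl⟩
      obtain ⟨y, hy, rfl⟩ := (hmemW w).mp hw
      exact ⟨y, hy, hν_mk i y⟩
    · rintro ⟨y, hy, rfl⟩
      exact ⟨Submodule.Quotient.mk y, (hmemW _).mpr ⟨y, hy, rfl⟩, (hν_mk i y).symm⟩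
  -- cardinalities: `#(M/S_i) · #(T^{c_i}W̄) = #M̄`
  have hcardS : ∀ i : ℕ,
      Nat.card (M ⧸ (Y.map (∑ l ∈ range (p ^ i), φ ^ l) ⊔ P)) * Nat.card (W.map (T ^ (p ^ i - 1))) =
        Nat.card (M ⧸ P) := by
    intro i
    set S : Submodule ℤ M := Y.map (∑ l ∈ range (p ^ i), φ ^ l) ⊔ P with hSdef
    have hPS : P ≤ S := le_sup_right
    have h1 : Nat.card (M ⧸ S) = Nat.card ((M ⧸ P) ⧸ S.map P.mkQ) :=
      (Nat.card_congr (Submodule.quotientQuotientEquivQuotient P S hPS).toEquiv).symm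
    -- the two images have the same elements
    have hset : ((S.map P.mkQ : Submodule ℤ (M ⧸ P)) : Set (M ⧸ P)) = (W.map (T ^ (p ^ i - 1)) : Set (M ⧸ P)) := by
      ext x
      rw [SetLike.mem_coe, SetLike.mem_coe, hmem_mapT]
      constructor
      · rintro ⟨s, hs, rfl⟩
        obtain ⟨a, ha, b, hb, rfl⟩ := Submodule.mem_sup.mp hs
        obtain ⟨y, hy, rfl⟩ := Submodule.mem_map.mp ha
        refine ⟨y, hy, ?_⟩
        change Submodule.Quotient.mk _ = Submodule.Quotient.mk _
        rw [Submodule.Quotient.eq, sub_add_cancel_left]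
        exact P.neg_mem hb
      · rintro ⟨y, hy, rfl⟩
        exact ⟨(∑ l ∈ range (p ^ i), φ ^ l) y, Submodule.mem_sup_left (Submodule.mem_map_of_mem hy), rfl⟩
    have h2 : Nat.card (S.map P.mkQ) = Nat.card (W.map (T ^ (p ^ i - 1))) :=
      Nat.card_congr (Equiv.setCongr hset)
    have h3 := Submodule.card_eq_card_quotient_mul_card (S.map P.mkQ)
    have h4 := Submodule.card_eq_card_quotient_mul_card (W.map (T ^ (p ^ i - 1)))
    -- `#(M̄ / S̄) = #(M̄ / T^cW̄)` since the subgroups have the same order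
    have h5 : Nat.card ((M ⧸ P) ⧸ S.map P.mkQ) = Nat.card ((M ⧸ P) ⧸ W.map (T ^ (p ^ i - 1))) := by
      have hpos : 0 < Nat.card (W.map (T ^ (p ^ i - 1))) := Nat.card_pos
      refine Nat.eq_of_mul_eq_mul_left hpos ?_
      rw [← h4, ← h2, ← h3]
    rw [h1, h5, mul_comm]
    exact h4.symm
  -- `#(T^cW̄) = p^{dim}` and the finrank inequality
  have hcardW : ∀ i : ℕ, Nat.card (W.map (T ^ (p ^ i - 1))) = p ^ finrank (ZMod p) (W.map (T ^ (p ^ i - 1))) := by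
    intro i
    rw [Module.natCard_eq_pow_finrank (K := ZMod p), Nat.card_zmod]
  have hcj := hcardS j
  have hck := hcardS k
  rw [hcardW j] at hcj
  rw [hcardW k] at hck
  set Dj := finrank (ZMod p) (W.map (T ^ (p ^ j - 1))) with hDj
  set Dk := finrank (ZMod p) (W.map (T ^ (p ^ k - 1))) with hDk
  set Qj := Nat.card (M ⧸ (Y.map (∑ l ∈ range (p ^ j), φ ^ l) ⊔ P)) with hQj
  set Qk := Nat.card (M ⧸ (Y.map (∑ l ∈ range (p ^ k), φ ^ l) ⊔ P)) with hQk
  -- from `Qk · p^{p^j} < Qj · p^{p^k}` and `Qj p^{Dj} = Qk p^{Dk}`: `Dj + p^j < Dk + p^k`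
  have hpj : 1 ≤ p ^ j := Nat.one_le_pow _ _ hp.pos
  have hpk : 1 ≤ p ^ k := Nat.one_le_pow _ _ hp.pos
  have hpjk : p ^ j ≤ p ^ k := Nat.pow_le_pow_right hp.pos hjk
  have hineq : Dj + p ^ j < Dk + p ^ k := by
    by_contra hge
    have hge' : Dk + p ^ k ≤ Dj + p ^ j := Nat.not_lt.mp hge
    -- multiply `hlt` by `p^{Dj}` and rewrite both sides through `#M̄`
    have h1 : Qk * p ^ (p ^ j) * p ^ Dj < Qj * p ^ (p ^ k) * p ^ Dj :=
      (Nat.mul_lt_mul_right (pow_pos hp.pos _)).mpr hlt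
    have h2 : Qj * p ^ (p ^ k) * p ^ Dj = Qk * p ^ Dk * p ^ (p ^ k) := by
      rw [mul_right_comm, hcj, ← hck]
    rw [h2] at h1
    -- `Qk · p^{p^j + Dj} < Qk · p^{Dk + p^k}` contradicts `Dk + p^k ≤ Dj + p^j`
    have h3 : Qk * p ^ (p ^ j) * p ^ Dj = Qk * p ^ (p ^ j + Dj) := by rw [mul_assoc, ← pow_add]
    have h4 : Qk * p ^ Dk * p ^ (p ^ k) = Qk * p ^ (Dk + p ^ k) := by rw [mul_assoc, ← pow_add]
    rw [h3, h4] at h1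
    have h5 : p ^ (p ^ j + Dj) < p ^ (Dk + p ^ k) := Nat.lt_of_mul_lt_mul_left h1
    have h6 := (Nat.pow_lt_pow_iff_right hp.one_lt).mp h5
    omega
  -- the chain lemma: `T^{p^k - 1}W̄ = 0`, hence `T^{p^{k'} - 1}W̄ = 0`
  have hbot : W.map (T ^ (p ^ k - 1)) = ⊥ :=
    map_pow_eq_bot_of_finrank_lt T hTnil hWT (Nat.sub_le_sub_right hpjk 1) (by rw [← hDj, ← hDk]; omega)
  have hpk' : p ^ k ≤ p ^ k' := Nat.pow_le_pow_right hp.pos hk'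
  have hbot' : W.map (T ^ (p ^ k' - 1)) = ⊥ := map_pow_eq_bot_of_le T (Nat.sub_le_sub_right hpk' 1) hbot
  -- conclusion: `ν_{k'} y ∈ pM` for `y ∈ Y`
  rintro _ ⟨y, hy, rfl⟩
  have hx : Submodule.Quotient.mk (p := P) ((∑ l ∈ range (p ^ k'), φ ^ l) y) ∈ W.map (T ^ (p ^ k' - 1)) :=
    (hmem_mapT k' _).mpr ⟨y, hy, rfl⟩
  rw [hbot', Submodule.mem_bot] at hx
  exact (Submodule.Quotient.mk_eq_zero P).mp hx

/-- **Consequence: all the quotients `M/(ν_{k'} Y + pM)`, `k' ≥ k`, have the same order** (`ν_{k'} Y ⊆ pM` makes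
`ν_{k'} Y + pM = pM`). [cite: Washington1997, §13.3 Lemma 13.18 and Prop. 13.22–13.23] -/
theorem card_quotient_eq_of_card_quotient_mul_lt (φ : Module.End ℤ M) {t : ℕ} (hφ : φ ^ p ^ t = 1) (Y : Submodule ℤ M)
    (hY : Y.map φ ≤ Y) {j k : ℕ} (hjk : j ≤ k)
    (hlt : Nat.card (M ⧸ (Y.map (∑ l ∈ range (p ^ k), φ ^ l) ⊔ (⊤ : Submodule ℤ M).map ((p : ℤ) • (1 : Module.End ℤ M)))) *
        p ^ (p ^ j) <
      Nat.card (M ⧸ (Y.map (∑ l ∈ range (p ^ j), φ ^ l) ⊔ (⊤ : Submodule ℤ M).map ((p : ℤ) • (1 : Module.End ℤ M)))) *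
        p ^ (p ^ k))
    {k' : ℕ} (hk' : k ≤ k') :
    Nat.card (M ⧸ (Y.map (∑ l ∈ range (p ^ k'), φ ^ l) ⊔ (⊤ : Submodule ℤ M).map ((p : ℤ) • (1 : Module.End ℤ M)))) =
      Nat.card (M ⧸ (Y.map (∑ l ∈ range (p ^ k), φ ^ l) ⊔ (⊤ : Submodule ℤ M).map ((p : ℤ) • (1 : Module.End ℤ M)))) := by
  have hk'le := map_geom_sum_le_of_card_quotient_mul_lt φ hφ Y hY hjk hlt hk'
  have hkle := map_geom_sum_le_of_card_quotient_mul_lt φ hφ Y hY hjk hlt le_rfl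
  rw [sup_eq_right.mpr hk'le, sup_eq_right.mpr hkle]

end RankJump

end Literature.NumberTheory.IwasawaTheory.FukudaRankJump

end
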